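import Mathlib
import Summits.ValiantsHypothesis.ValiantsHypothesis.Theorems.BarrierLeverPartitionMinorsHitByVPHiddenStatesPairBallJoin

/-!
# Route BarrierLever — item `PartitionMinorsHitByVP` (stmt-ValiantsHypothesis-19717), line `hidden_states`:
# THE PAIR-BALL JOIN WITH MIXED SHAPES — BP on the window ⇒ the conjecture node for EVERY `r` in range

Helper file (`--supports stmt-ValiantsHypothesis-19717`; cell valiant-natproofs, rung V4, 𝒟-side door (c), line `hidden_states`,
node #1 `stub_universalJoinWide`; prover seat val-np-p3 gen 20; seat memo MEMO-blockpeeling-valnp3-g20 §13–§14). Bookkeeping `def`s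
only (`wt`, `members`, `design`, `bOf`). Closes NO item.

`…HiddenStatesPairBallJoin` gives the node at `r = m(1 + K + C(b,2))` (all pieces of one shape). Here piece `p` has its own number
`bv p` of CHEAP states (weight 1) and `kv p` of LIVE states (cheap or free, weight 2); the other states are DEAD (weight 3). Members =
weight `≤ 2`: `1 + kv p + C(bv p, 2)` per piece (`card_members`), every piece a complete pair-ball piece, uniform under BP. Choosing the
shapes (`bOf`, elementary arithmetic) every `r` with `1 + β₁ + C(β₁,2) ≤ r ≤ 2h(1 + h³ + C(β₂,2))` is a sum of `≤ 2h` piece sizes: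
* **`universalJoinWide_of_bp2_shapes`** — BP(β₁, β₂) ⇒ the node body at `r = Σ_p (1 + kv p + C(bv p,2))` (`β₁ ≤ bv p ≤ β₂`, `bv p ≤ kv p ≤ K ≤ h³`).
* **`universalJoinWide_of_bp2_range`** — BP(β₁, β₂), `β₁ ≤ β₂`, `2β₂ + 1 ≤ h³`, `2(1 + β₁ + C(β₁,2)) ≤ 1 + h³ + C(β₂,2)` ⇒ the body of
  `Stmt.stub_universalJoinWide` for EVERY `r` with `1 + β₁ + C(β₁,2) ≤ r ≤ 2h(1 + h³ + C(β₂,2))`, ALL injective `u`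
  (below `1 + β₁ + C(β₁,2) ≤ 2h⁴` the star joins `StarJoin.universalJoinWide_of_le` already serve). Window of record `[h²/4, h³/8]`: reach `≈ h⁷/64`.
WHAT THIS IS NOT: BP is not proved; item 19717 OPEN; nothing on crux 14610 or VP ≠ VNP.
-/

set_option linter.dupNamespace false

namespace Summit.ValiantsHypothesis.ValiantsHypothesis.Theorems.BarrierLever.HiddenStates

open Finset Matrix

noncomputable section

namespace PairBallMix

open PairBallJoin (cheap card_cheap mem_cheap)

variable {h m K : ℕ}

/-! ## 1. The mixed design -/

/-- State weights of piece `p`: cheap (`q < bv p`) `1`, live free (`bv p ≤ q < kv p`) `2`, dead `3`. -/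
def wt (bv kv : Fin m → ℕ) (p : Fin m) (q : Fin K) : ℕ :=
  if (q : ℕ) < bv p then 1 else if (q : ℕ) < kv p then 2 else 3

/-- The members: every (piece, state set) of weight `≤ 2`. -/
def members (K : ℕ) (bv kv : Fin m → ℕ) : Finset (Fin m × Finset (Fin K)) :=
  Finset.univ.filter fun x : Fin m × Finset (Fin K) => ∑ q ∈ x.2, wt bv kv x.1 q ≤ 2

/-- The design: an enumeration of the members. -/
def design (K : ℕ) (bv kv : Fin m → ℕ) (k : Fin (members K bv kv).card) : Fin m × Finset (Fin K) :=
  (((members K bv kv).equivFin.symm k : members K bv kv) : Fin m × Finset (Fin K))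

/-- Every state weighs at least `1`. -/
theorem one_le_wt (bv kv : Fin m → ℕ) (p : Fin m) (q : Fin K) : 1 ≤ wt bv kv p q := by
  unfold wt; split_ifs <;> omega

/-- Cheap states weigh `1`. -/
theorem wt_of_mem_cheap {bv kv : Fin m → ℕ} {p : Fin m} {q : Fin K} (hq : q ∈ cheap K (bv p)) : wt bv kv p q = 1 := by
  unfold wt; rw [if_pos (mem_cheap.mp hq)]

/-- Non-cheap states weigh at least `2`. -/
theorem two_le_wt_of_not_mem_cheap {bv kv : Fin m → ℕ} {p : Fin m} {q : Fin K} (hq : q ∉ cheap K (bv p)) :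
    2 ≤ wt bv kv p q := by
  unfold wt; rw [if_neg (fun hh => hq (mem_cheap.mpr hh))]; split_ifs <;> omega

/-- A state of weight `≤ 2` is live (when `bv p ≤ kv p`). -/
theorem mem_live_of_wt_le_two {bv kv : Fin m → ℕ} {p : Fin m} (hbk : bv p ≤ kv p) {q : Fin K} (hq : wt bv kv p q ≤ 2) :
    q ∈ cheap K (kv p) := by
  rw [mem_cheap]
  unfold wt at hq
  split_ifs at hq with h1 h2
  · exact lt_of_lt_of_le h1 hbk
  · exact h2
  · omega

/-- The design enumerates members. -/
theorem design_mem (K : ℕ) (bv kv : Fin m → ℕ) (k : Fin (members K bv kv).card) : design K bv kv k ∈ members K bv kv :=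
  ((members K bv kv).equivFin.symm k).2

/-- The design is injective. -/
theorem design_injective (K : ℕ) (bv kv : Fin m → ℕ) : Function.Injective (design K bv kv) := by
  intro k k' hkk'
  exact (members K bv kv).equivFin.symm.injective (Subtype.ext hkk')

/-- Every member is in the range of the design. -/
theorem mem_range_design {bv kv : Fin m → ℕ} {x : Fin m × Finset (Fin K)} (hx : x ∈ members K bv kv) :
    x ∈ Set.range (design K bv kv) :=
  ⟨(members K bv kv).equivFin ⟨x, hx⟩, by simp [design]⟩

/-- Members weigh at most `2`. -/
theorem weight_le_two_of_mem {bv kv : Fin m → ℕ} {x : Fin m × Finset (Fin K)} (hx : x ∈ members K bv kv) :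
    ∑ q ∈ x.2, wt bv kv x.1 q ≤ 2 := (Finset.mem_filter.mp hx).2

/-- The strict threshold (piece offsets `0`). -/
theorem design_threshold (K : ℕ) (bv kv : Fin m → ℕ) :
    ∀ x : Fin m × Finset (Fin K), x ∉ Set.range (design K bv kv) →
      ∀ i, (fun _ : Fin m => 0) (design K bv kv i).1 + ∑ q ∈ (design K bv kv i).2, wt bv kv (design K bv kv i).1 q <
        (fun _ : Fin m => 0) x.1 + ∑ q ∈ x.2, wt bv kv x.1 q := by
  intro x hx i
  have hxw : ¬ ∑ q ∈ x.2, wt bv kv x.1 q ≤ 2 := fun hh =>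
    hx (mem_range_design (Finset.mem_filter.mpr ⟨Finset.mem_univ _, hh⟩))
  have hiw := weight_le_two_of_mem (design_mem K bv kv i)
  simp only [zero_add]
  omega

/-! ## 2. Shape and count of the members -/

/-- The cardinality of a state set is at most its weight. -/
theorem card_le_weight (bv kv : Fin m → ℕ) (p : Fin m) (J : Finset (Fin K)) : J.card ≤ ∑ q ∈ J, wt bv kv p q := by
  rw [Finset.card_eq_sum_ones]
  exact Finset.sum_le_sum fun q _ => one_le_wt bv kv p q

/-- A nonempty member set of piece `p` is a cheap single, a cheap pair, or a non-cheap single. -/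
theorem shape_of_weight_le_two {bv kv : Fin m → ℕ} {p : Fin m} (J : Finset (Fin K)) (hJ : ∑ q ∈ J, wt bv kv p q ≤ 2)
    (hne : J ≠ ∅) : J ⊆ cheap K (bv p) ∧ (J.card = 1 ∨ J.card = 2) ∨ ∃ f, f ∉ cheap K (bv p) ∧ J = {f} := by
  classical
  have hcard : J.card ≤ 2 := (card_le_weight bv kv p J).trans hJ
  have hpos : 0 < J.card := Finset.card_pos.mpr (Finset.nonempty_iff_ne_empty.mpr hne)
  by_cases hall : ∀ q ∈ J, q ∈ cheap K (bv p)
  · exact Or.inl ⟨fun q hq => hall q hq, by omega⟩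
  · push Not at hall
    obtain ⟨f, hfJ, hf⟩ := hall
    refine Or.inr ⟨f, hf, ?_⟩
    have hsplit : ∑ q ∈ J, wt bv kv p q = wt bv kv p f + ∑ q ∈ J.erase f, wt bv kv p q := (Finset.add_sum_erase J _ hfJ).symm
    have hrest : (J.erase f).card ≤ ∑ q ∈ J.erase f, wt bv kv p q := card_le_weight bv kv p _
    have hf2 := two_le_wt_of_not_mem_cheap (kv := kv) hf
    have h0 : (J.erase f).card = 0 := by omega
    have hJ1 : J.card = 1 := by rw [Finset.card_erase_of_mem hfJ] at h0; omega
    obtain ⟨f', hf'⟩ := Finset.card_eq_one.mp hJ1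
    rw [hf'] at hfJ
    rw [hf', Finset.mem_singleton.mp hfJ]

/-- The member state sets of piece `p`: `∅`, the live singles, the cheap pairs. -/
theorem filter_weight_eq {bv kv : Fin m → ℕ} (p : Fin m) (hbk : bv p ≤ kv p) :
    (Finset.univ.filter fun J : Finset (Fin K) => ∑ q ∈ J, wt bv kv p q ≤ 2) =
      (Finset.univ.powersetCard 0 ∪ (cheap K (kv p)).powersetCard 1) ∪ (cheap K (bv p)).powersetCard 2 := by
  classical
  have hsub : cheap K (bv p) ⊆ cheap K (kv p) := fun q hq => mem_cheap.mpr (lt_of_lt_of_le (mem_cheap.mp hq) hbk)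
  ext J
  simp only [Finset.mem_filter, Finset.mem_univ, true_and, Finset.mem_union, Finset.mem_powersetCard,
    Finset.subset_univ]
  constructor
  · intro hJ
    by_cases hne : J = ∅
    · exact Or.inl (Or.inl (by rw [hne, Finset.card_empty]))
    · rcases shape_of_weight_le_two J hJ hne with ⟨hsubJ, h1 | h2⟩ | ⟨f, -, hf⟩
      · exact Or.inl (Or.inr ⟨fun q hq => hsub (hsubJ hq), h1⟩)
      · exact Or.inr ⟨hsubJ, h2⟩
      · refine Or.inl (Or.inr ⟨?_, by rw [hf, Finset.card_singleton]⟩)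
        rw [hf, Finset.singleton_subset_iff]
        rw [hf, Finset.sum_singleton] at hJ
        exact mem_live_of_wt_le_two hbk hJ
  · rintro ((h0 | ⟨hl, h1⟩) | ⟨hsubJ, h2⟩)
    · rw [Finset.card_eq_zero.mp h0, Finset.sum_empty]; omega
    · obtain ⟨q, rfl⟩ := Finset.card_eq_one.mp h1
      rw [Finset.sum_singleton]
      have hq : q ∈ cheap K (kv p) := hl (Finset.mem_singleton_self q)
      unfold wt
      split_ifs with h1' h2' <;> first | omega | exact absurd (mem_cheap.mp hq) h2'
    · rw [Finset.sum_congr rfl fun q hq => wt_of_mem_cheap (kv := kv) (hsubJ hq)]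
      simp [h2]

/-- **`#members = Σ_p (1 + kv p + C(bv p, 2))`** (`bv p ≤ kv p ≤ K`). -/
theorem card_members (bv kv : Fin m → ℕ) (hbk : ∀ p, bv p ≤ kv p) (hkK : ∀ p, kv p ≤ K) :
    (members K bv kv).card = ∑ p : Fin m, (1 + kv p + (bv p).choose 2) := by
  classical
  have hpiece : ∀ p : Fin m, (Finset.univ.filter fun J : Finset (Fin K) => ∑ q ∈ J, wt bv kv p q ≤ 2).card =
      1 + kv p + (bv p).choose 2 := by
    intro p
    rw [filter_weight_eq p (hbk p), Finset.card_union_of_disjoint, Finset.card_union_of_disjoint, Finset.card_powersetCard,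
      Finset.card_powersetCard, Finset.card_powersetCard, card_cheap (hkK p), card_cheap ((hbk p).trans (hkK p)),
      Finset.card_univ, Fintype.card_fin]
    · simp
    · exact Finset.disjoint_left.mpr fun J h0 h1 => by
        rw [Finset.mem_powersetCard] at h0 h1; omega
    · exact Finset.disjoint_left.mpr fun J h01 h2 => by
        rw [Finset.mem_union, Finset.mem_powersetCard, Finset.mem_powersetCard] at h01
        rw [Finset.mem_powersetCard] at h2
        omega
  have hsigma : members K bv kv =
      (((Finset.univ : Finset (Fin m)).sigma
        (fun p => Finset.univ.filter fun J : Finset (Fin K) => ∑ q ∈ J, wt bv kv p q ≤ 2)).map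
        (Equiv.sigmaEquivProd (Fin m) (Finset (Fin K))).toEmbedding) := by
    ext x
    simp only [members, Finset.mem_filter, Finset.mem_univ, true_and, Finset.mem_map, Finset.mem_sigma,
      Equiv.toEmbedding_apply, Equiv.sigmaEquivProd_apply]
    constructor
    · intro hx
      exact ⟨⟨x.1, x.2⟩, hx, rfl⟩
    · rintro ⟨⟨p, J⟩, hJ, rfl⟩
      exact hJ
  rw [hsigma, Finset.card_map, Finset.card_sigma]
  exact Finset.sum_congr rfl fun p _ => hpiece p

/-! ## 3. Every piece is a uniform pair-ball piece -/

/-- **BP ⇒ the mixed pair-ball join is good for every injective `u`.** -/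
theorem design_good {β₁ β₂ : ℕ} (hBP : ∀ n, PairBall.Stmt.bp2 β₁ β₂ h n) (bv kv : Fin m → ℕ) (hbK : ∀ p, bv p ≤ K)
    (hβ : ∀ p, β₁ ≤ bv p) (hβ' : ∀ p, bv p ≤ β₂)
    (u : Fin (members K bv kv).card → Finset (Fin h)) (hu : Function.Injective u) :
    ∃ T : Fin m → Option (Fin K) → Fin h → ℂ,
      (Matrix.of fun i k : Fin (members K bv kv).card => ∏ a ∈ u i,
        (T (design K bv kv k).1 none a + ∑ q ∈ (design K bv kv k).2, T (design K bv kv k).1 (some q) a)).det ≠ 0 := by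
  classical
  refine SimplexJoin.good_of_uniform_pieces_join h m K _ u (design K bv kv) hu (design_injective K bv kv) ?_
  intro p n c hc hcp hsurj v hv
  set cols : Fin n → Finset (Fin K) := fun x => (design K bv kv (c x)).2 with hcols
  have hcols_inj : Function.Injective cols := by
    intro x x' hxx'
    have : design K bv kv (c x) = design K bv kv (c x') := Prod.ext ((hcp x).trans (hcp x').symm) hxx'
    exact hc (design_injective K bv kv this)
  have h0mem : ((p, (∅ : Finset (Fin K))) : Fin m × Finset (Fin K)) ∈ members K bv kv :=
    Finset.mem_filter.mpr ⟨Finset.mem_univ _, by simp⟩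
  obtain ⟨k₀', hk₀'⟩ := mem_range_design h0mem
  obtain ⟨x₀, hx₀⟩ := hsurj k₀' (by rw [hk₀'])
  have hcols0 : cols x₀ = ∅ := by simp only [hcols, hx₀, hk₀']
  obtain ⟨n', rfl⟩ : ∃ n', n = n' + 1 := ⟨n - 1, by have := x₀.2; omega⟩
  -- weights of the columns of the piece `p` are `p`-weights
  have hwp : ∀ x, ∑ q ∈ cols x, wt bv kv p q ≤ 2 := by
    intro x
    have hmem : design K bv kv (c x) ∈ members K bv kv := design_mem K bv kv _
    have := weight_le_two_of_mem hmem
    rw [hcp x] at this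
    exact this
  have hshape : PairBall.IsPairBall (fun x : Fin n' => cols (x₀.succAbove x)) (cheap K (bv p)) := by
    refine ⟨fun x x' hxx' => Fin.succAbove_right_injective (hcols_inj hxx'), fun x => ?_⟩
    have hne : cols (x₀.succAbove x) ≠ ∅ := by
      intro hh
      have : cols (x₀.succAbove x) = cols x₀ := hh.trans hcols0.symm
      exact Fin.succAbove_ne x₀ x (hcols_inj this)
    exact shape_of_weight_le_two _ (hwp _) hne
  have hmemcol : ∀ J : Finset (Fin K), (p, J) ∈ members K bv kv → J ≠ ∅ → ∃ x : Fin n', cols (x₀.succAbove x) = J := by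
    intro J hJ hJne
    obtain ⟨k, hk⟩ := mem_range_design hJ
    obtain ⟨x, hx⟩ := hsurj k (by rw [hk])
    have hx0 : x ≠ x₀ := by
      intro hh
      apply hJne
      have : cols x = J := by simp only [hcols, hx, hk]
      rw [← this, hh, hcols0]
    obtain ⟨x', rfl⟩ := Fin.exists_succAbove_eq hx0
    exact ⟨x', by simp only [hcols, hx, hk]⟩
  have hcomplete : PairBall.IsComplete (fun x : Fin n' => cols (x₀.succAbove x)) (cheap K (bv p)) := by
    refine ⟨fun q hq => hmemcol {q} ?_ (Finset.singleton_ne_empty q), fun q hq q' hq' hqq' => hmemcol {q, q'} ?_ ?_⟩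
    · exact Finset.mem_filter.mpr ⟨Finset.mem_univ _, by simp [wt_of_mem_cheap (kv := kv) hq]⟩
    · exact Finset.mem_filter.mpr ⟨Finset.mem_univ _, by
        simp [Finset.sum_pair hqq', wt_of_mem_cheap (kv := kv) hq, wt_of_mem_cheap (kv := kv) hq']⟩
    · exact (Finset.insert_nonempty q {q'}).ne_empty
  have hβ₁ : β₁ ≤ (cheap K (bv p)).card := by rw [card_cheap (hbK p)]; exact hβ p
  have hβ₂ : (cheap K (bv p)).card ≤ β₂ := by rw [card_cheap (hbK p)]; exact hβ' p
  exact PairBall.exists_table (hBP n') cols x₀ hcols0 (cheap K (bv p)) hshape hβ₁ hβ₂ hcomplete v hv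

/-! ## 4. The node at every sum of piece sizes, and at every `r` in range -/

/-- **BP ⇒ THE CONJECTURE NODE AT `r = Σ_p (1 + kv p + C(bv p, 2))`.** -/
theorem universalJoinWide_of_bp2_shapes {β₁ β₂ : ℕ} (hBP : ∀ n, PairBall.Stmt.bp2 β₁ β₂ h n) (bv kv : Fin m → ℕ)
    (hm : m ≤ h + h) (hK : K ≤ h * h * h) (hbk : ∀ p, bv p ≤ kv p) (hkK : ∀ p, kv p ≤ K)
    (hβ : ∀ p, β₁ ≤ bv p) (hβ' : ∀ p, bv p ≤ β₂) (r : ℕ) (hr : r = ∑ p : Fin m, (1 + kv p + (bv p).choose 2)) :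
    ∃ (m K : ℕ) (W : Fin m → ℕ) (wt : Fin m → Fin K → ℕ) (e : Fin r → Fin m × Finset (Fin K)),
      m ≤ h + h ∧ K ≤ h * h * h ∧ Function.Injective e ∧
      (∀ x : Fin m × Finset (Fin K), x ∉ Set.range e →
        ∀ i, W (e i).1 + ∑ k ∈ (e i).2, wt (e i).1 k < W x.1 + ∑ k ∈ x.2, wt x.1 k) ∧
      ∀ u : Fin r → Finset (Fin h), Function.Injective u →
        ∃ tx : Fin m → Option (Fin K) → Fin h → ℂ,
          (Matrix.of fun i k : Fin r =>
            ∏ a ∈ u i, (tx (e k).1 none a + ∑ q ∈ (e k).2, tx (e k).1 (some q) a)).det ≠ 0 := by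
  classical
  have hcard : (members K bv kv).card = r := by rw [card_members bv kv hbk hkK, hr]
  subst hcard
  exact ⟨m, K, fun _ => 0, wt bv kv, design K bv kv, hm, hK, design_injective K bv kv, design_threshold K bv kv,
    fun u hu => design_good hBP bv kv (fun p => (hbk p).trans (hkK p)) hβ hβ' u hu⟩

/-- The number of cheap states realising a piece of size `t`: the largest `b ≤ β₂` with `1 + b + C(b,2) ≤ t`. -/
def bOf (β₂ t : ℕ) : ℕ := Nat.findGreatest (fun b => 1 + b + b.choose 2 ≤ t) β₂

/-- `bOf` realises a piece of size `≤ t`. -/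
theorem bOf_spec {β₁ β₂ t : ℕ} (hβ : β₁ ≤ β₂) (ht : 1 + β₁ + β₁.choose 2 ≤ t) : 1 + bOf β₂ t + (bOf β₂ t).choose 2 ≤ t := by
  have hP : (fun b => 1 + b + b.choose 2 ≤ t) (Nat.findGreatest (fun b => 1 + b + b.choose 2 ≤ t) β₂) :=
    Nat.findGreatest_spec (P := fun b => 1 + b + b.choose 2 ≤ t) hβ ht
  exact hP

/-- `β₁ ≤ bOf` as soon as `β₁` fits. -/
theorem le_bOf {β₁ β₂ t : ℕ} (hβ : β₁ ≤ β₂) (ht : 1 + β₁ + β₁.choose 2 ≤ t) : β₁ ≤ bOf β₂ t :=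
  Nat.le_findGreatest hβ ht

/-- `bOf ≤ β₂`. -/
theorem bOf_le (β₂ t : ℕ) : bOf β₂ t ≤ β₂ := Nat.findGreatest_le _

/-- The live count `t − 1 − C(b,2)` of a piece of size `t` is at most `max(2 β₂ + 1, t − 1 − C(β₂,2))`. -/
theorem live_le {β₂ t : ℕ} : t - 1 - (bOf β₂ t).choose 2 ≤ 2 * β₂ + 1 ∨ bOf β₂ t = β₂ := by
  by_cases hb : bOf β₂ t = β₂
  · exact Or.inr hb
  · left
    have hlt : bOf β₂ t < β₂ := lt_of_le_of_ne (bOf_le β₂ t) hb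
    -- maximality: `bOf + 1` fails
    have hfail : ¬ (1 + (bOf β₂ t + 1) + (bOf β₂ t + 1).choose 2 ≤ t) := by
      have := Nat.findGreatest_is_greatest (P := fun b => 1 + b + b.choose 2 ≤ t) (n := β₂) (k := bOf β₂ t + 1)
        (by unfold bOf; exact Nat.lt_succ_self _) (by unfold bOf at hlt ⊢; exact Nat.succ_le_of_lt hlt)
      exact this
    have hchoose : (bOf β₂ t + 1).choose 2 = bOf β₂ t + (bOf β₂ t).choose 2 := by
      rw [Nat.choose_succ_succ' (bOf β₂ t) 1, Nat.choose_one_right]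
    omega

/-- `Σ_{p < j} [p < rem] = rem` for `rem ≤ j`. -/
theorem sum_indicator_lt (j rem : ℕ) (hrem : rem ≤ j) :
    ∑ p : Fin j, (if (p : ℕ) < rem then 1 else 0) = rem := by
  rw [Finset.sum_boole, Nat.cast_id]
  exact card_cheap hrem

/-- **BP ON THE WINDOW ⇒ THE CONJECTURE NODE FOR EVERY `r` IN RANGE.** With `β₁ ≤ β₂`, `2β₂ + 1 ≤ h³` and
`2(1 + β₁ + C(β₁,2)) ≤ 1 + h³ + C(β₂,2)`: for every `r` with `1 + β₁ + C(β₁,2) ≤ r ≤ 2h(1 + h³ + C(β₂,2))` the body of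
`Stmt.stub_universalJoinWide` holds at `(h, r)`, for ALL injective row families. -/
theorem universalJoinWide_of_bp2_range {β₁ β₂ : ℕ} (hBP : ∀ n, PairBall.Stmt.bp2 β₁ β₂ h n) (hβ : β₁ ≤ β₂)
    (hβ₂ : 2 * β₂ + 1 ≤ h * h * h) (hAB : 2 * (1 + β₁ + β₁.choose 2) ≤ 1 + h * h * h + β₂.choose 2)
    (r : ℕ) (hlo : 1 + β₁ + β₁.choose 2 ≤ r) (hhi : r ≤ (h + h) * (1 + h * h * h + β₂.choose 2)) :
    ∃ (m K : ℕ) (W : Fin m → ℕ) (wt : Fin m → Fin K → ℕ) (e : Fin r → Fin m × Finset (Fin K)),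
      m ≤ h + h ∧ K ≤ h * h * h ∧ Function.Injective e ∧
      (∀ x : Fin m × Finset (Fin K), x ∉ Set.range e →
        ∀ i, W (e i).1 + ∑ k ∈ (e i).2, wt (e i).1 k < W x.1 + ∑ k ∈ x.2, wt x.1 k) ∧
      ∀ u : Fin r → Finset (Fin h), Function.Injective u →
        ∃ tx : Fin m → Option (Fin K) → Fin h → ℂ,
          (Matrix.of fun i k : Fin r =>
            ∏ a ∈ u i, (tx (e k).1 none a + ∑ q ∈ (e k).2, tx (e k).1 (some q) a)).det ≠ 0 := by
  classical
  set A := 1 + β₁ + β₁.choose 2 with hA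
  set Bm := 1 + h * h * h + β₂.choose 2 with hBm
  have hApos : 0 < A := by omega
  -- the number of pieces
  set X := r / A with hX
  have hXpos : 0 < X := Nat.div_pos hlo hApos
  set j := min (h + h) X with hj
  have hjle : j ≤ h + h := min_le_left _ _
  have hjX : j ≤ X := min_le_right _ _
  have hh : 1 ≤ h := by
    rcases Nat.eq_zero_or_pos h with h0 | h0
    · subst h0; simp at hβ₂
    · exact h0
  have hjpos : 0 < j := lt_min (by omega) hXpos
  have hjA : j * A ≤ r := (Nat.mul_le_mul_right A hjX).trans (Nat.div_mul_le_self r A)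
  have hjB : r ≤ j * Bm := by
    rcases le_total (h + h) X with hc | hc
    · rw [hj, min_eq_left hc]; exact hhi
    · rw [hj, min_eq_right hc]
      have hdm : A * X + r % A = r := Nat.div_add_mod r A
      have hmod : r % A < A := Nat.mod_lt r hApos
      have hY : A ≤ A * X := Nat.le_mul_of_pos_right A hXpos
      have hXB : X * (2 * A) ≤ X * Bm := Nat.mul_le_mul_left X hAB
      have hring : X * (2 * A) = 2 * (A * X) := by ring
      omega
  -- piece sizes `q` and `q + 1`
  set q := r / j with hq
  set rem := r % j with hremdef
  have hqr : j * q + rem = r := Nat.div_add_mod r j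
  have hrem : rem < j := Nat.mod_lt r hjpos
  have hqA : A ≤ q := (Nat.le_div_iff_mul_le hjpos).mpr (by rw [Nat.mul_comm]; exact hjA)
  have hqB : q ≤ Bm := Nat.div_le_of_le_mul hjB
  have hq1B : 0 < rem → q + 1 ≤ Bm := by
    intro hpos
    have hlt : j * q < j * Bm := by
      calc j * q < j * q + rem := by omega
        _ = r := hqr
        _ ≤ j * Bm := hjB
    exact Nat.succ_le_of_lt (Nat.lt_of_mul_lt_mul_left hlt)
  -- the shapes
  set t : Fin j → ℕ := fun p => q + (if (p : ℕ) < rem then 1 else 0) with ht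
  have htA : ∀ p, A ≤ t p := fun p => by simp only [ht]; split_ifs <;> omega
  have htB : ∀ p, t p ≤ Bm := fun p => by
    simp only [ht]
    split_ifs with hp
    · exact hq1B (by omega)
    · omega
  set bv : Fin j → ℕ := fun p => bOf β₂ (t p) with hbv
  set kv : Fin j → ℕ := fun p => t p - 1 - (bOf β₂ (t p)).choose 2 with hkv
  have hspec : ∀ p, 1 + bv p + (bv p).choose 2 ≤ t p := fun p => bOf_spec hβ (htA p)
  have hbk : ∀ p, bv p ≤ kv p := fun p => by have := hspec p; simp only [hbv, hkv] at this ⊢; omega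
  have hkK : ∀ p, kv p ≤ h * h * h := by
    intro p
    rcases live_le (β₂ := β₂) (t := t p) with h1 | h2
    · simp only [hkv]; omega
    · have := htB p
      simp only [hkv, h2, hBm] at this ⊢
      omega
  have hβlo : ∀ p, β₁ ≤ bv p := fun p => le_bOf hβ (htA p)
  have hβhi : ∀ p, bv p ≤ β₂ := fun p => bOf_le β₂ (t p)
  have hsum : r = ∑ p : Fin j, (1 + kv p + (bv p).choose 2) := by
    have hterm : ∀ p, 1 + kv p + (bv p).choose 2 = t p := fun p => by
      have := hspec p; simp only [hbv, hkv] at this ⊢; omega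
    rw [Finset.sum_congr rfl fun p _ => hterm p]
    simp only [ht]
    rw [Finset.sum_add_distrib, Finset.sum_const, Finset.card_univ, Fintype.card_fin, smul_eq_mul,
      sum_indicator_lt j rem hrem.le]
    rw [← hqr]
  exact universalJoinWide_of_bp2_shapes hBP bv kv hjle le_rfl hbk hkK hβlo hβhi r hsum

end PairBallMix

end

end Summit.ValiantsHypothesis.ValiantsHypothesis.Theorems.BarrierLever.HiddenStates
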